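import Summits.AnomalousDissipation.AnomalousDissipation.Theorems.NeutralTaylorWavesTaylorWaveQuasiSteadyLine
import Literature.Analysis.FunctionSpaces.TorusEnstrophyOrthogonality

/-!
# Stub `stub_residualTransferW` of the line `windfibred`
# (crux stmt-AnomalousDissipation-16293, `NeutralTaylorWaves.TaylorWaveQuasiSteady`)

**Two-scale evaluation / residual transfer** (the registered signature, verbatim, is the last theorem).
Given the profile-level data of the line — a smooth profile `P : T⁴ → ℝ³`, a pressure profile `Q : T⁴ → ℝ`,
a drift `c`, at level `n` (wavelength `ε = epsN n = 1/(n+1)`, viscosity `ν_n = ε²`), with pointwise energy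
bound `‖P‖² ≤ E`, vanishing horizontal means of the evaluated field, two-scale incompressibility
`tsDiv = 0` and two-scale residual `‖tsResidual‖² ≤ C ν_n^K` — the FIELD-LEVEL witness of the crux clause is
obtained by EVALUATING the profile on the fast phase and removing the (vertical) mean by an exact Galilean
shift:

* `W := P ∘ e_n` (`e_n = phaseMap j G n : T³ → T⁴`, `x ↦ (x, θ_n x)`), `v := ∫ W` (so `v₀ = v₁ = 0` by
  hypothesis), `w := W - v`, `q := Q ∘ e_n`, `c' := c - v₂`, `C₂ := C + √E`.

Proof obligations and where they are met:
* §2 the real lift `𝓔 : ℝ³ → ℝ⁴`, `y ↦ (y, (n+1)(j·y + G(proj y)))` of the phase map: `proj ∘ 𝓔 = e_n ∘ proj`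
  (`proj_phaseLift`), smoothness and derivative (`contDiff_phaseLift`, `hasFDerivAt_phaseLift`), whence
  smoothness of `Φ ∘ e_n` (`isSmooth_comp_phaseMap`) and the **first-order chain rule**
  `∂ᵢ(Φ ∘ e_n) = (D^ε_i Φ) ∘ e_n` (`partialDeriv_comp_phaseMap`; `D^ε_i = ∂ᵢ + ε⁻¹kᵢ∂_θ = tsDeriv`);
* §3 the exact pointwise identity `residual(w)(x) = tsResidual ε j G f P Q c (e_n x)` (`residual_eq`: the
  chain rule once for `(w·∇)w`, `∇q`, `∂₂w` and twice for `Δw = ∑ ∂ᵢ∂ᵢw`, the inner function `D^ε_i P` being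
  smooth on `T⁴` (`isSmooth_tsDeriv`); the vertical Galilean shift is exact:
  `(W - v)·∇(W - v) - (c - v₂)∂₂(W - v) = W·∇W - c∂₂W` when `v₀ = v₁ = 0`);
* §4 the registered stub: smoothness, `div w = (tsDiv P) ∘ e_n = 0`, `∫ w = 0`, `|c'| ≤ C + ‖v‖ ≤ C + √E`,
  `∫‖W - ∫W‖² ≤ ∫‖W‖² ≤ E` (variance bound on a probability space), `‖∇w‖² = ‖∇W‖²` (a constant shift),
  and `∫‖residual‖² ≤ C ν^K ≤ C₂ ν^K` (pointwise bound, probability space).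

Pure calculus; sources: folklore (two-scale/WKB evaluation `U(x, φ(x)/ε)` and the operators
`∂ₓ + ε⁻¹∇φ ∂_θ`, e.g. Cheverry–Guès–Métivier, Ann. Sci. ENS 36 (2003) §2).  Tree tools: `FlatTorus`
(`lift`, `proj`, `IsSmooth`), `TorusCalculus(Proofs)` (`fderiv_lift`, `partialDeriv_eq_fderiv_apply`,
`fderiv_apply_eq_sum_partialDeriv`, `laplacian_eq_sum_partialDeriv_partialDeriv`), `TorusSpaceTime`
(`gradient_eq_sum_partialDeriv`), `TorusEnstrophyOrthogonality` (`divergence_eq_sum_partialDeriv_apply`).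
-/

-- `Summit.<Summit>.<Problem>` is the tree's mandated summit-side namespace (CONVENTIONS §2); for this
-- single-conjunct summit the two coincide, so the duplicate is deliberate.
set_option linter.dupNamespace false

noncomputable section

open scoped BigOperators Topology InnerProductSpace ContDiff
open Filter MeasureTheory
open Literature.Analysis.FunctionSpaces Literature.Analysis.FunctionSpaces.Torus

namespace Summit.AnomalousDissipation.AnomalousDissipation.Theorems.TaylorWaveQuasiSteady.ResidualTransfer

open Summit.AnomalousDissipation.AnomalousDissipation.Theorems.TaylorWaveQuasiSteady

/-! ## §1 Elementary rewrites -/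

/-- The slow point of `e_n x = (x, θ_n x)` is `x`. [folklore] -/
@[simp]
theorem slow_phaseMap (j : Fin 3 → ℤ) (G : UnitAddTorus (Fin 3) → ℝ) (n : ℕ) (x : UnitAddTorus (Fin 3)) :
    slow (phaseMap j G n x) = x := by
  funext i
  simp [slow, phaseMap]

/-- `ε_n⁻¹ = n + 1`. [folklore] -/
theorem inv_epsN (n : ℕ) : (epsN n)⁻¹ = (n : ℝ) + 1 := by
  rw [epsN, one_div, inv_inv]

/-- `m • ↑r = ↑(m r)` in `ℝ/ℤ` for an integer `m` and a real `r`. [folklore] -/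
theorem zsmul_coe_unitAddCircle (m : ℤ) (r : ℝ) :
    m • ((r : ℝ) : UnitAddCircle) = (((m : ℝ) * r : ℝ) : UnitAddCircle) := by
  rw [← AddCircle.coe_zsmul, zsmul_eq_mul]

/-- The fast phase read on the covering space `ℝ³`: `θ_n (proj y) = ↑((n+1)(j·y + G(proj y)))`. [folklore] -/
theorem fastPhase_proj (j : Fin 3 → ℤ) (G : UnitAddTorus (Fin 3) → ℝ) (n : ℕ) (y : EuclideanSpace ℝ (Fin 3)) :
    fastPhase j G n (Torus.proj y) =
      ((((n : ℝ) + 1) * (∑ i : Fin 3, (j i : ℝ) * y i + Torus.lift G y) : ℝ) : UnitAddCircle) := by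
  unfold fastPhase
  simp only [Torus.proj_apply, Torus.lift_apply, zsmul_coe_unitAddCircle]
  rw [← QuotientAddGroup.mk_sum, ← QuotientAddGroup.mk_add]
  congr 1
  push_cast
  rw [mul_add, Finset.mul_sum]
  simp only [mul_assoc]

/-! ## §2 The real lift of the phase map and the first-order chain rule -/

-- The real lift `𝓔 : ℝ³ → ℝ⁴` of the phase map, `y ↦ (y, (n+1)(j·y + G(proj y)))`, is written out in the
-- standard basis of `ℝ⁴` as `∑ᵢ yᵢ e_{i} + ((n+1)(∑ᵢ jᵢyᵢ + lift G y)) e_θ` (`e_θ = e_{last}`) wherever it occurs.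

/-- `proj ∘ 𝓔 = e_n ∘ proj`: the real lift covers the phase map. [folklore] -/
theorem proj_phaseLift (j : Fin 3 → ℤ) (G : UnitAddTorus (Fin 3) → ℝ) (n : ℕ) (y : EuclideanSpace ℝ (Fin 3)) :
    Torus.proj
        ((∑ i : Fin 3, y i • EuclideanSpace.single (Fin.castSucc i) (1 : ℝ)) +
          (((n : ℝ) + 1) * (∑ i : Fin 3, (j i : ℝ) * y i + Torus.lift G y)) •
            EuclideanSpace.single (Fin.last 3) (1 : ℝ) : EuclideanSpace ℝ (Fin 4)) =
      phaseMap j G n (Torus.proj y) := by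
  have hne : ∀ i : Fin 3, Fin.last 3 ≠ Fin.castSucc i := fun i => (Fin.castSucc_ne_last i).symm
  funext k
  rw [Torus.proj_apply]
  induction k using Fin.lastCases with
  | last =>
      simp only [phaseMap, Fin.snoc_last, fastPhase_proj, PiLp.add_apply, PiLp.smul_apply, WithLp.ofLp_sum,
        Finset.sum_apply, PiLp.single_apply, hne, if_false, smul_eq_mul, mul_zero, Finset.sum_const_zero,
        if_true, mul_one, zero_add]
  | cast i =>
      simp only [phaseMap, Fin.snoc_castSucc, Torus.proj_apply, PiLp.add_apply, PiLp.smul_apply,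
        WithLp.ofLp_sum, Finset.sum_apply, PiLp.single_apply, Fin.castSucc_inj, Fin.castSucc_ne_last,
        if_false, smul_eq_mul, mul_zero, add_zero, mul_ite, mul_one, Finset.sum_ite_eq, Finset.mem_univ,
        if_true]

/-- The real lift `𝓔` is smooth when `G` is. [folklore] -/
theorem contDiff_phaseLift (j : Fin 3 → ℤ) {G : UnitAddTorus (Fin 3) → ℝ} (hG : IsSmooth G) (n : ℕ) :
    ContDiff ℝ ∞ fun y : EuclideanSpace ℝ (Fin 3) =>
      ((∑ i : Fin 3, y i • EuclideanSpace.single (Fin.castSucc i) (1 : ℝ)) +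
        (((n : ℝ) + 1) * (∑ i : Fin 3, (j i : ℝ) * y i + Torus.lift G y)) •
          EuclideanSpace.single (Fin.last 3) (1 : ℝ) : EuclideanSpace ℝ (Fin 4)) := by
  have hc : ∀ i : Fin 3, ContDiff ℝ ∞ (fun y : EuclideanSpace ℝ (Fin 3) => y i) := fun i =>
    (EuclideanSpace.proj i : EuclideanSpace ℝ (Fin 3) →L[ℝ] ℝ).contDiff
  exact (ContDiff.sum fun i _ => (hc i).smul contDiff_const).add
    ((contDiff_const.mul ((ContDiff.sum fun i _ => contDiff_const.mul (hc i)).add hG)).smul contDiff_const)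

/-- The derivative of the real lift: `D𝓔(y) eᵢ = e_{i} + (n+1) kᵢ(proj y) e_θ` with `k = ∇G + j`
(`phaseGrad`). [folklore] -/
theorem hasFDerivAt_phaseLift (j : Fin 3 → ℤ) {G : UnitAddTorus (Fin 3) → ℝ} (hG : IsSmooth G) (n : ℕ)
    (y : EuclideanSpace ℝ (Fin 3)) :
    ∃ L : EuclideanSpace ℝ (Fin 3) →L[ℝ] EuclideanSpace ℝ (Fin 4),
      HasFDerivAt (fun z : EuclideanSpace ℝ (Fin 3) =>
          ((∑ i : Fin 3, z i • EuclideanSpace.single (Fin.castSucc i) (1 : ℝ)) +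
            (((n : ℝ) + 1) * (∑ i : Fin 3, (j i : ℝ) * z i + Torus.lift G z)) •
              EuclideanSpace.single (Fin.last 3) (1 : ℝ) : EuclideanSpace ℝ (Fin 4))) L y ∧
        ∀ i : Fin 3, L (EuclideanSpace.single i 1) =
          EuclideanSpace.single (Fin.castSucc i) 1 +
            (((n : ℝ) + 1) * phaseGrad j G i (Torus.proj y)) • EuclideanSpace.single (Fin.last 3) 1 := by
  have hG1 : IsContDiff 1 G := hG.isContDiff (by simp)
  have hpr : ∀ i : Fin 3, HasFDerivAt (fun z : EuclideanSpace ℝ (Fin 3) => z i)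
      (EuclideanSpace.proj i : EuclideanSpace ℝ (Fin 3) →L[ℝ] ℝ) y := fun i =>
    (EuclideanSpace.proj i : EuclideanSpace ℝ (Fin 3) →L[ℝ] ℝ).hasFDerivAt
  have hlift : HasFDerivAt (Torus.lift G) (Torus.fderiv G (Torus.proj y)) y := by
    rw [← Torus.fderiv_lift]
    exact ((hG.differentiable (by simp)).differentiableAt).hasFDerivAt
  refine ⟨_, (HasFDerivAt.fun_sum (u := Finset.univ) fun i _ =>
      (hpr i).smul_const (EuclideanSpace.single (Fin.castSucc i) (1 : ℝ))).add
    ((((HasFDerivAt.fun_sum (u := Finset.univ) fun i _ => (hpr i).const_mul (j i : ℝ)).add hlift).const_mul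
      ((n : ℝ) + 1)).smul_const (EuclideanSpace.single (Fin.last 3) (1 : ℝ))), fun i => ?_⟩
  simp only [_root_.add_apply, sum_apply, ContinuousLinearMap.smulRight_apply,
    _root_.smul_apply, PiLp.proj_apply, PiLp.single_apply, ite_smul, one_smul, zero_smul,
    Finset.sum_ite_eq', Finset.mem_univ, if_true, smul_eq_mul, mul_ite, mul_one, mul_zero]
  rw [← partialDeriv_eq_fderiv_apply hG1, phaseGrad, add_comm (partialDeriv i G (Torus.proj y))]

/-- The lift of an evaluated profile factors through the real lift: `lift (Φ ∘ e_n) = lift Φ ∘ 𝓔`. [folklore] -/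
theorem lift_comp_phaseMap {F : Type*} (Φ : UnitAddTorus (Fin 4) → F) (j : Fin 3 → ℤ)
    (G : UnitAddTorus (Fin 3) → ℝ) (n : ℕ) :
    Torus.lift (fun x => Φ (phaseMap j G n x)) = Torus.lift Φ ∘ fun y : EuclideanSpace ℝ (Fin 3) =>
      ((∑ i : Fin 3, y i • EuclideanSpace.single (Fin.castSucc i) (1 : ℝ)) +
        (((n : ℝ) + 1) * (∑ i : Fin 3, (j i : ℝ) * y i + Torus.lift G y)) •
          EuclideanSpace.single (Fin.last 3) (1 : ℝ) : EuclideanSpace ℝ (Fin 4)) := by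
  funext y
  rw [Torus.lift_apply, Function.comp_apply, Torus.lift_apply, proj_phaseLift]

variable {F : Type*} [NormedAddCommGroup F] [NormedSpace ℝ F]

/-- **Evaluated profiles are smooth**: `x ↦ Φ (e_n x)` is smooth on `T³` for smooth `Φ` on `T⁴` and smooth `G`.
[folklore] -/
theorem isSmooth_comp_phaseMap (j : Fin 3 → ℤ) {G : UnitAddTorus (Fin 3) → ℝ} {Φ : UnitAddTorus (Fin 4) → F}
    (hG : IsSmooth G) (hΦ : IsSmooth Φ) (n : ℕ) : IsSmooth (fun x => Φ (phaseMap j G n x)) := by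
  unfold IsSmooth
  rw [lift_comp_phaseMap]
  exact hΦ.comp (contDiff_phaseLift j hG n)

/-- **First-order chain rule through the phase map**: `∂ᵢ (Φ ∘ e_n) (x) = (D^ε_i Φ)(e_n x)` with
`D^ε_i = ∂ᵢ + ε⁻¹ kᵢ ∂_θ` (`tsDeriv`), `ε = ε_n`, `ε⁻¹ = n + 1`. [folklore] -/
theorem partialDeriv_comp_phaseMap {j : Fin 3 → ℤ} {G : UnitAddTorus (Fin 3) → ℝ} {Φ : UnitAddTorus (Fin 4) → F}
    (hG : IsSmooth G) (hΦ : IsSmooth Φ) (n : ℕ) (i : Fin 3) (x : UnitAddTorus (Fin 3)) :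
    partialDeriv i (fun x => Φ (phaseMap j G n x)) x = tsDeriv (epsN n) j G i Φ (phaseMap j G n x) := by
  obtain ⟨y, rfl⟩ := Torus.proj_surjective x
  have hΦ1 : IsContDiff 1 Φ := hΦ.isContDiff (by simp)
  have hW : IsSmooth (fun x => Φ (phaseMap j G n x)) := isSmooth_comp_phaseMap j hG hΦ n
  obtain ⟨L, hL, hLi⟩ := hasFDerivAt_phaseLift j hG n y
  have hcomp : HasFDerivAt (Torus.lift (fun x => Φ (phaseMap j G n x)))
      ((Torus.fderiv Φ (phaseMap j G n (Torus.proj y))).comp L) y := by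
    rw [lift_comp_phaseMap]
    refine HasFDerivAt.comp y ?_ hL
    refine (((hΦ.differentiable (by simp)).differentiableAt).hasFDerivAt).congr_fderiv ?_
    rw [Torus.fderiv_lift, proj_phaseLift]
  rw [partialDeriv_eq_fderiv_apply (hW.isContDiff (by simp)), ← Torus.fderiv_lift, hcomp.fderiv,
    ContinuousLinearMap.comp_apply, hLi, map_add, map_smul, tsDeriv, partialDeriv_eq_fderiv_apply hΦ1,
    partialDeriv_eq_fderiv_apply hΦ1, slow_phaseMap, inv_epsN]

/-- Functions of the slow variables only are smooth on `T⁴`: `y ↦ g (slow y)`. [folklore] -/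
theorem isSmooth_comp_slow {g : UnitAddTorus (Fin 3) → F} (hg : IsSmooth g) :
    IsSmooth (fun y : UnitAddTorus (Fin 4) => g (slow y)) := by
  have h : Torus.lift (fun y : UnitAddTorus (Fin 4) => g (slow y)) =
      Torus.lift g ∘ fun z : EuclideanSpace ℝ (Fin 4) =>
        (WithLp.toLp 2 fun i : Fin 3 => z (Fin.castSucc i) : EuclideanSpace ℝ (Fin 3)) := by
    funext z
    rfl
  unfold IsSmooth
  rw [h]
  refine hg.comp ?_
  rw [contDiff_piLp]
  intro i
  exact (EuclideanSpace.proj (Fin.castSucc i) : EuclideanSpace ℝ (Fin 4) →L[ℝ] ℝ).contDiff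

/-- The two-scale derivative `D^ε_i Φ` of a smooth profile is a smooth profile. [folklore] -/
theorem isSmooth_tsDeriv (ε : ℝ) (j : Fin 3 → ℤ) {G : UnitAddTorus (Fin 3) → ℝ} {Φ : UnitAddTorus (Fin 4) → F}
    (hG : IsSmooth G) (hΦ : IsSmooth Φ) (i : Fin 3) : IsSmooth (tsDeriv ε j G i Φ) := by
  have h1 : IsSmooth (fun y : UnitAddTorus (Fin 4) => ε⁻¹ * phaseGrad j G i (slow y)) := by
    have h := isSmooth_comp_slow (hg := hG.partialDeriv i)
    exact (ContDiff.mul contDiff_const (ContDiff.add h contDiff_const) :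
      IsSmooth fun y : UnitAddTorus (Fin 4) => ε⁻¹ * (partialDeriv i G (slow y) + (j i : ℝ)))
  exact (hΦ.partialDeriv i.castSucc).add (h1.smul' (hΦ.partialDeriv (Fin.last 3)))

/-! ## §3 The exact residual identity -/

/-- Partial derivatives ignore additive constants (function form). [folklore] -/
theorem partialDeriv_sub_const (g : UnitAddTorus (Fin 3) → F) (v : F) (i : Fin 3) :
    partialDeriv i (fun y => g y - v) = partialDeriv i g := by
  funext x
  simp only [Torus.partialDeriv, Torus.lineDeriv, deriv_sub_const]

/-- **The residual identity.** For `W = P ∘ e_n`, a constant vector `v` with `v₀ = v₁ = 0`, `w = W - v`,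
`q = Q ∘ e_n`: `(w·∇)w - ν_nΔw + ∇q - (c - v₂)∂₂w - f = (tsResidual ε_n j G f P Q c) ∘ e_n` pointwise
(chain rule, `Δ = ∑ ∂ᵢ∂ᵢ`, `ν_n = ε_n²`, and the exact vertical Galilean shift). [folklore] -/
theorem residual_eq {j : Fin 3 → ℤ} {G : UnitAddTorus (Fin 3) → ℝ}
    {P : UnitAddTorus (Fin 4) → EuclideanSpace ℝ (Fin 3)} {Q : UnitAddTorus (Fin 4) → ℝ}
    (hG : IsSmooth G) (hP : IsSmooth P) (hQ : IsSmooth Q) (f : UnitAddTorus (Fin 3) → EuclideanSpace ℝ (Fin 3))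
    (n : ℕ) (c : ℝ) {v : EuclideanSpace ℝ (Fin 3)} (hv0 : v 0 = 0) (hv1 : v 1 = 0) (x : UnitAddTorus (Fin 3)) :
    convect (fun x => P (phaseMap j G n x) - v) (fun x => P (phaseMap j G n x) - v) x
        - nuN n • Torus.laplacian (fun x => P (phaseMap j G n x) - v) x
        + Torus.gradient (fun x => Q (phaseMap j G n x)) x
        - (c - v 2) • partialDeriv (2 : Fin 3) (fun x => P (phaseMap j G n x) - v) x - f x =
      tsResidual (epsN n) j G f P Q c (phaseMap j G n x) := by
  have hWs : IsSmooth (fun x => P (phaseMap j G n x)) := isSmooth_comp_phaseMap j hG hP n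
  have hws : IsSmooth (fun x => P (phaseMap j G n x) - v) := hWs.sub (isSmooth_const v)
  have hqs : IsSmooth (fun x => Q (phaseMap j G n x)) := isSmooth_comp_phaseMap j hG hQ n
  have hd2 : ∀ i, partialDeriv i (partialDeriv i fun x => P (phaseMap j G n x)) x =
      tsDeriv (epsN n) j G i (tsDeriv (epsN n) j G i P) (phaseMap j G n x) := by
    intro i
    have h : partialDeriv i (fun x => P (phaseMap j G n x)) =
        fun x => tsDeriv (epsN n) j G i P (phaseMap j G n x) :=
      funext fun x => partialDeriv_comp_phaseMap hG hP n i x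
    rw [h]
    exact partialDeriv_comp_phaseMap hG (isSmooth_tsDeriv (epsN n) j hG hP i) n i x
  have hgrad : Torus.gradient (fun x => Q (phaseMap j G n x)) x = tsGrad (epsN n) j G Q (phaseMap j G n x) := by
    rw [gradient_eq_sum_partialDeriv (hqs.isContDiff (by simp))]
    ext k
    simp [tsGrad, WithLp.ofLp_sum, Finset.sum_apply, Pi.single_apply, partialDeriv_comp_phaseMap hG hQ]
  rw [convect, fderiv_apply_eq_sum_partialDeriv (hws.isContDiff (by simp)),
    laplacian_eq_sum_partialDeriv_partialDeriv hws, hgrad]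
  simp only [partialDeriv_sub_const, hd2, partialDeriv_comp_phaseMap hG hP, tsResidual, tsConvect,
    tsLaplacian, slow_phaseMap, nuN, PiLp.sub_apply, sub_smul, Fin.sum_univ_three, hv0, hv1, zero_smul,
    sub_zero]
  abel

/-- The variance bound on a probability space: `∫ ‖W - ∫W‖² ≤ ∫ ‖W‖²` for continuous `W` on `T³`. [folklore] -/
theorem integral_norm_sq_sub_integral_le {W : UnitAddTorus (Fin 3) → EuclideanSpace ℝ (Fin 3)}
    (hW : Continuous W) : ∫ x, ‖W x - ∫ y, W y‖ ^ 2 ≤ ∫ x, ‖W x‖ ^ 2 := by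
  set v : EuclideanSpace ℝ (Fin 3) := ∫ y, W y with hv
  have hWi : Integrable W := hW.integrable_unitAddTorus
  have h1 : Integrable (fun x => ‖W x‖ ^ 2) := (hW.norm.pow 2).integrable_unitAddTorus
  have h2 : Integrable (fun x => ⟪v, W x⟫_ℝ) := (continuous_const.inner hW).integrable_unitAddTorus
  have hpt : ∀ x, ‖W x - v‖ ^ 2 = ‖W x‖ ^ 2 - 2 * ⟪v, W x⟫_ℝ + ‖v‖ ^ 2 := fun x => by
    rw [norm_sub_sq_real, real_inner_comm]
  have h3 : Integrable (fun x => 2 * ⟪v, W x⟫_ℝ) := h2.const_mul 2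
  have h4 : Integrable (fun x => ‖W x‖ ^ 2 - 2 * ⟪v, W x⟫_ℝ) := h1.sub h3
  simp_rw [hpt]
  rw [integral_add h4 (integrable_const _), integral_sub h1 h3, integral_const_mul, integral_inner hWi v,
    integral_const, probReal_univ, one_smul, ← hv, real_inner_self_eq_norm_sq]
  nlinarith [sq_nonneg ‖v‖]

/-! ## §4 The registered stub -/

/-- **stub_residualTransferW** (two-scale evaluation / residual transfer; the registered signature, verbatim).
Given the level-`n` profiles `P`, `Q`, drift `c` with `‖P‖² ≤ E`, vanishing horizontal means of `P ∘ e_n`,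
`tsDiv P = 0` and `‖tsResidual‖² ≤ C ν_n^K`, the field `w := P ∘ e_n - ∫ P ∘ e_n`, pressure `q := Q ∘ e_n` and
drift `c' := c - (∫ P ∘ e_n)₂` are smooth, divergence free, mean zero, with `|c'| ≤ C + √E`, `∫‖w‖² ≤ E`,
`‖∇w‖² = ‖∇(P ∘ e_n)‖²` and steady residual `≤ (C + √E) ν_n^K` (`residual_eq`). [folklore] -/
theorem stub_residualTransferW : ∀ (j : Fin 3 → ℤ) (G : UnitAddTorus (Fin 3) → ℝ) (f : UnitAddTorus (Fin 3) → EuclideanSpace ℝ (Fin 3)) (E C : ℝ) (K : ℕ), Literature.Analysis.FunctionSpaces.Torus.IsSmooth G → ∃ C₂ : ℝ, ∀ (n : ℕ) (P : UnitAddTorus (Fin 4) → EuclideanSpace ℝ (Fin 3)) (Q : UnitAddTorus (Fin 4) → ℝ) (c : ℝ), Literature.Analysis.FunctionSpaces.Torus.IsSmooth P → Literature.Analysis.FunctionSpaces.Torus.IsSmooth Q → |c| ≤ C → (∀ y, ‖P y‖ ^ 2 ≤ E) → (∫ x, P (phaseMap j G n x)) 0 = 0 → (∫ x, P (phaseMap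 j G n x)) 1 = 0 → (∀ y, tsDiv (epsN n) j G P y = 0) → (∀ y, ‖tsResidual (epsN n) j G f P Q c y‖ ^ 2 ≤ C * nuN n ^ K) → ∃ (w : UnitAddTorus (Fin 3) → EuclideanSpace ℝ (Fin 3)) (q : UnitAddTorus (Fin 3) → ℝ) (c' : ℝ), Literature.Analysis.FunctionSpaces.Torus.IsSmooth w ∧ Literature.Analysis.FunctionSpaces.Torus.IsSmooth q ∧ Literature.Analysis.FunctionSpaces.Torus.IsDivFree w ∧ Literature.Analysis.FunctionSpaces.Torus.HasZeroMean w ∧ |c'| ≤ C₂ ∧ MeasureTheory.integral MeasureTheory.volume (fun x => ‖w x‖ ^ 2) ≤ E ∧ Literature.Analysis.FunctionSpaces.Torus.gradNormSq w = Literature.Analysis.FunctionSpaces.Torus.gradNormSq (fun x => P (phaseMap j G n x)) ∧ MeasureTheory.integral MeasureTheory.volume (fun x => ‖Literature.Analysis.FunctionSpaces.Torus.convect w w x - (nuN n) • Literature.Analysis.FunctionSpaces.Torus.laplacian w x + Literature.Analysis.FunctionSpaces.Torus.gradient q x - c' • Literature.Analysis.FunctionSpaces.Torus.partialDeriv (2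 : Fin 3) w x - f x‖ ^ 2) ≤ C₂ * (nuN n) ^ K := by
  intro j G f E C K hG
  refine ⟨C + Real.sqrt E, ?_⟩
  intro n P Q c hP hQ hc hPE hm0 hm1 hdiv hres
  -- the evaluated field, its mean and the witnesses
  have hWs : IsSmooth (fun x => P (phaseMap j G n x)) := isSmooth_comp_phaseMap j hG hP n
  set v : EuclideanSpace ℝ (Fin 3) := ∫ x, P (phaseMap j G n x) with hv
  have hws : IsSmooth (fun x => P (phaseMap j G n x) - v) := hWs.sub (isSmooth_const v)
  have hWi : Integrable (fun x => P (phaseMap j G n x)) := hWs.integrable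
  have hnorm : ∀ x, ‖P (phaseMap j G n x)‖ ≤ Real.sqrt E := fun x => by
    have h := Real.abs_le_sqrt (hPE (phaseMap j G n x))
    rwa [abs_of_nonneg (norm_nonneg _)] at h
  have hvE : ‖v‖ ≤ Real.sqrt E := by
    have h : ‖v‖ ≤ Real.sqrt E * (volume : Measure (UnitAddTorus (Fin 3))).real Set.univ := by
      rw [hv]
      exact norm_integral_le_of_norm_le_const (ae_of_all _ hnorm)
    rwa [probReal_univ, mul_one] at h
  refine ⟨fun x => P (phaseMap j G n x) - v, fun x => Q (phaseMap j G n x), c - v 2, hws,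
    isSmooth_comp_phaseMap j hG hQ n, ?_, ?_, ?_, ?_, ?_, ?_⟩
  · -- divergence free: `div w = (tsDiv P) ∘ e_n = 0`
    intro x
    rw [divergence_eq_sum_partialDeriv_apply (hws.isContDiff (by simp))]
    simp only [partialDeriv_sub_const, partialDeriv_comp_phaseMap hG hP]
    exact hdiv _
  · -- mean zero
    show ∫ x, (P (phaseMap j G n x) - v) = 0
    rw [integral_sub hWi (integrable_const v), integral_const, probReal_univ, one_smul, ← hv, sub_self]
  · -- drift
    have h2 : |v 2| ≤ ‖v‖ := by
      have h := PiLp.norm_apply_le v 2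
      rwa [Real.norm_eq_abs] at h
    calc |c - v 2| ≤ |c| + |v 2| := abs_sub c (v 2)
      _ ≤ C + Real.sqrt E := add_le_add hc (h2.trans hvE)
  · -- energy
    calc ∫ x, ‖P (phaseMap j G n x) - v‖ ^ 2 ≤ ∫ x, ‖P (phaseMap j G n x)‖ ^ 2 :=
          integral_norm_sq_sub_integral_le hWs.continuous
      _ ≤ ∫ _x : UnitAddTorus (Fin 3), E :=
          integral_mono hWs.norm_sq.integrable (integrable_const E) fun x => hPE (phaseMap j G n x)
      _ = E := by rw [integral_const, probReal_univ, one_smul]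
  · -- enstrophy: a constant shift does not change `∂ᵢ`
    simp only [gradNormSq, partialDeriv_sub_const]
  · -- the steady residual
    have hpt : ∀ x, ‖convect (fun x => P (phaseMap j G n x) - v) (fun x => P (phaseMap j G n x) - v) x
        - nuN n • Torus.laplacian (fun x => P (phaseMap j G n x) - v) x
        + Torus.gradient (fun x => Q (phaseMap j G n x)) x
        - (c - v 2) • partialDeriv (2 : Fin 3) (fun x => P (phaseMap j G n x) - v) x - f x‖ ^ 2 ≤
        C * nuN n ^ K := fun x => by
      rw [residual_eq hG hP hQ f n c hm0 hm1 x]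
      exact hres _
    calc _ ≤ ∫ _x : UnitAddTorus (Fin 3), C * nuN n ^ K :=
          integral_mono_of_nonneg (ae_of_all _ fun x => sq_nonneg _) (integrable_const _) (ae_of_all _ hpt)
      _ = C * nuN n ^ K := by rw [integral_const, probReal_univ, one_smul]
      _ ≤ (C + Real.sqrt E) * nuN n ^ K :=
          mul_le_mul_of_nonneg_right (le_add_of_nonneg_right (Real.sqrt_nonneg E)) (pow_nonneg (nuN_pos n).le K)

end Summit.AnomalousDissipation.AnomalousDissipation.Theorems.TaylorWaveQuasiSteady.ResidualTransfer

end
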